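import Summits.QuantumFields.YangMills.Theorems.BalabanUVNodesK0Stub1FlatAveragingDictionary
import Literature.MathematicalPhysics.QuantumFieldTheory.Balaban1983to89.BlockAveragingTwoLevel
import Literature.MathematicalPhysics.QuantumFieldTheory.BalabanImbrieJaffe1984to88.BIJ85GaugeFnBound513

/-!
# K0⁷ STUB 1 (`stub_prop8StepCoP13`), sub-target S4a — THE MULTI-LEVEL FLAT AVERAGING DICTIONARY, part 1 (geometry):
# **TOUCHED CENTRES OF A NESTED FAMILY** — the depth profile (2.4), lattice neighbours of a centre, the hierarchical comb functional on a block where `Q_iZ`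
# vanishes, and the COLLISION LEMMA: under the collar property two end-points of index bonds of levels `j < j′` with the SAME centre are `(emb y′, y′)` with
# `j′ = j + 1`, `y′` an outer-boundary site all of whose sub-blocks are `Λ_j`-sites, and `Λ_jZ(y) = Λ_{j′}Z(y′)` for every `Z` in print's multi-level kernel

Cell `pub-ymgap`, width seat `pub-ymgap-k0-s1-w1` g5 (CLAIM-1 ∕ INTENT-1, bus I.31516 ∕ I.31580; split for the 400-line cap: this is file 1∕2, file 2∕2 =
`…K0Stub1FlatAveragingDictionaryLevels`).  `--kind proof --supports stmt-QuantumFields-20541 --as helper`; count-neutral.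
[15] = [Balaban1985Variational]; [B5] = [Balaban1984PropagatorsI]; [B6] = [Balaban1984PropagatorsII]; [B7] = [Balaban1985Averaging]; [I] = [Balaban1987RG1].

WHY.  The multi-level dictionary (file 2∕2) regauges a field `Z` of print's multi-level kernel (`Q_jZ(c) = 0` at every index bond `(j,c)` of a nested family
`Ω₁ ⊃ … ⊃ Ω_k`, [B6] (2.1)–(2.6)) into the record's kernel (`Q_j(1)`, dag-n07-w1's `dIterL j 1`) by ONE gauge function `ν` with `ν(embIter j y) = Λ_jZ(y)` at the
centre of every TOUCHED `j`-site `y` (end-point of an index bond): the equations `Q_j(1)(Z + ∂ν)(c) = 0` read `ν(ctr c₊) − ν(ctr c₋) = Λ_jZ(c₊) − Λ_jZ(c₋)` exactly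
(p602768 `dIterL_one_eq_sub_comb` + `dIterL_one_grad`).  Centres of different levels coincide iff the lower site is the central descendant of the higher one, so
`ν` is well defined iff colliding touched sites carry the same comb value.  THIS FILE proves that under the COLLAR property (UST `Prop8Chart`'s hypothesis shape
`∀ i e, LamBond (i+1) e → ∀ z, blockOf z ∈ {e₋, e₊} → z ∈ Ω_i^{(i)}`, ⇐ `Adm22 D R M` with `2L ≤ R·M + 1` by `collar_of_adm22`) the only collisions are `(j, j+1)` at an
OUTER-boundary site `y′ ∉ Ω_{j+1}^{(j+1)}` adjacent to `Λ_{j+1}`, whose sub-blocks are all `Λ_j`-sites, so that `Q_jZ ≡ 0` inside `B(y′)` and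
`Λ_{j+1}Z(y′) = L^j·λ̄(Q_jZ)(y′) + Λ_jZ(emb y′) = Λ_jZ(emb y′)` (locality of the comb mean [B7] (62): UST `ChartHInv.combMean_congr_stairs` + `T4Continuum.blockOf_ends_of_mem_stairWalk`).
The mechanism is the DEPTH PROFILE (2.4) (`B6SectADomainsV1` §5: every fine site `x` has exactly one level `j₀` with `B^{j₀}(x) ∈ Λ_{j₀}`, and `x ∈ Ω_i ↔ i ≤ j₀`):
a touched `j`-site over `x` has `j = j₀` (the `Λ_j`-site), or `j = j₀ + 1` (OUTER boundary, by the collar), or `j + 1 ≤ j₀` (INNER crossing into `Ω_{j+1}`, with a non-deep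
lattice neighbour — impossible for a site central in its `(j+1)`-block, whose neighbours lie in the same block since `L ≥ 3`).  WITHOUT the collar an outer-boundary block
with unconstrained internal bonds gives an inconsistent mixed-level cycle (the transfer then fails for some `Z`; not typed).

An INDEX READING is a family `I j : PBond P j → Prop` with (hI₁) every index bond has a `Λ_j`-site end-point and (hI₂) a `j`-bond with both end-points `Λ_j`-sites is an
index bond — inhabited by [B6] (2.3) `D.LamBond` (lit-balaban's `BondIdx D`, the heart's `Q_V`) and by B15 reading (b) `bondsOf (genSet … j)` of the regions
`{x | D.InOm i x}` (dag-n07-w2's `Node00.mem_bondsOf_genSet_inOm_iff`) — see file 2∕2 §4.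

WHAT IS PROVED (sorry-free; no definition; axioms standard; `M = M_N(ℂ)`).
* §0 `embIter_eq_embIter_iterBlockOf` (nested centres), `iterBlockOf_embIter_eq_emb`, `embIter_injective`, `one_le_half_pred_L`, ★ `blockOf_emb_shift` ∕ `blockOf_eq_of_shift_eq_emb`
  (lattice neighbours of a centre lie in its block), `inOm_of_le_depth` ∕ `not_inOm_of_depth_lt` (the depth profile), `not_deep_of_not_mem`.
* §1 `combFamily_unique` (the recursion `Λ₀ = 0`, `Λ_{i+1} = Lⁱ·λ̄(Q_i·) + Λ_i∘emb` determines `Λ`), ★ `comb_succ_eq_of_block` (`Q_iZ = 0` inside `B(y)` ⇒ `Λ_{i+1}Z(y) = Λ_iZ(emb y)`),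
  `norm_combFamily_le` ∕ `norm_combFamily_le'` (SUP LETTER `‖Λ_jZ(y)‖ ≤ (d+2)·L·s·(L^j−1)∕(L−1) ≤ (d+2)·L^{j+1}·s` for `‖Z‖ ≤ s`, operator norm on `M_N(ℂ)`; UST `norm_combMean_le`).
* §2 `touched_normal_form`, `lamBond_of_touched_not_mem`, ★ `depth_cases_of_touched` (the trichotomy), ★★ `comb_eq_of_collision`.

HONEST SCOPE.  Lattice bookkeeping over kernel-checked identities; NO estimate; nothing of Bałaban's analysis asserted; `stub_prop8StepCoP13` ∕ K0⁷ NOT closed; N07 NOT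
discharged; counts unmoved (28∕28 · 5∕27); one finite 𝕋⁴ programme at fixed ε — R4 closes the conditional finite-𝕋⁴ rung `BalabanLadder.UV` only, never the summit; the
YM mass gap (Clay) is NOT proved by any of this; nothing continuum ∕ ℝ⁴ ∕ OS.  No `sorry`, no `def`, no `instance`, no `notation`.

References: [B6] (2.1)–(2.4), (2.6) p.224, (2.20) p.226; [15] (4) p.278, (44)–(47) p.285, (150) p.301; [B5] (1.18)–(1.20) p.20; [B7] (11) p.18, (62) p.28;
[I] (0.1)–(0.4) pp.251–253; [Balaban1988Convergent] (2.2) p.255, (2.10) p.256.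
-/

set_option autoImplicit false
noncomputable section
open scoped BigOperators Matrix Matrix.Norms.L2Operator

namespace Summit.QuantumFields.YangMills.Theorems.K0Stub1TouchedCentresOfDomains

open Literature.MathematicalPhysics.QuantumFieldTheory.Balaban1983to89
open LatticeFieldCalculus (bondAvgIter)
open BlockAveragingEMLLinearised (combMean)
open B5Eq118OneStroke (iterBlockOf iterBlockOf_zero iterBlockOf_succ)
open B15DeterminingSets (embIter)
open B6SectADomainsV1 (Domains)
open Summit.QuantumFields.YangMills.Theorems.ChartHInv (combMean_congr_stairs combMean_zero)

variable {P : Params} {N : ℕ}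

/-! ## §0  Lattice lemmas: nested centres, neighbours of a centre, the depth profile (2.4) -/

/-- **NESTED CENTRES**: the centre of a `j`-site is the centre of its `i`-fold block point for every `i ≤ j` ([I] (0.1): each lattice is the lattice of centres of the
next). [cite: Balaban1987RG1, (0.1) p.251] -/
theorem embIter_eq_embIter_iterBlockOf : ∀ (j i : ℕ), i ≤ j → j ≤ P.m + P.K → ∀ y : Site P j,
    embIter j y = embIter i (iterBlockOf i (embIter j y))
  | 0, i, hij, _, y => by
    obtain rfl : i = 0 := Nat.le_zero.mp hij
    rfl
  | j + 1, i, hij, hj, y => by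
    rcases Nat.lt_or_eq_of_le hij with hlt | rfl
    · exact embIter_eq_embIter_iterBlockOf j i (Nat.lt_succ_iff.mp hlt) (Nat.le_of_succ_le hj) (emb y)
    · rw [Node00.iterBlockOf_embIter (j + 1) hj]

/-- For `i < j` the `i`-fold block point of the centre of a `j`-site is the CENTRE sub-site of its `(i+1)`-fold block point. [cite: Balaban1987RG1, (0.1) p.251] -/
theorem iterBlockOf_embIter_eq_emb {j i : ℕ} (hij : i < j) (hj : j ≤ P.m + P.K) (y : Site P j) :
    iterBlockOf i (embIter j y) = emb (iterBlockOf (i + 1) (embIter j y)) := by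
  have h := embIter_eq_embIter_iterBlockOf j (i + 1) hij hj y
  conv_lhs => rw [h]
  exact Node00.iterBlockOf_embIter i (by omega) _

/-- The centre map `embIter j : T^{(j)} → T_η` is injective (standing range). [cite: Balaban1987RG1, (0.1) p.251] -/
theorem embIter_injective {j : ℕ} (hj : j ≤ P.m + P.K) : Function.Injective (embIter (P := P) j) := fun y y' h => by
  rw [← Node00.iterBlockOf_embIter j hj y, h, Node00.iterBlockOf_embIter j hj y']

/-- `1 ≤ (L − 1)∕2`: the block size is odd and `> 1`, hence `≥ 3`. [cite: Balaban1987RG1, §0 p.251] -/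
theorem one_le_half_pred_L (P : Params) : 1 ≤ (P.L - 1) / 2 := by
  obtain ⟨⟨m, hm⟩, h1⟩ := P.hL
  omega

/-- **A LATTICE NEIGHBOUR OF A CENTRE LIES IN THE SAME BLOCK** (forward step; `L ≥ 3`). [cite: Balaban1987RG1, (0.3) p.252] -/
theorem blockOf_emb_shift {j : ℕ} (hj : j + 1 ≤ P.m + P.K) (y : Site P (j + 1)) (μ : Fin P.d) : blockOf ((emb y).shift μ) = y := by
  refine T4Continuum.blockOf_eq_of_near_emb hj y _ (fun ν => if ν = μ then 1 else 0) (fun ν => ?_) (fun ν => ?_)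
  · rw [Site.shift_apply]
    by_cases h : ν = μ
    · subst h; simp
    · simp [h]
  · have := one_le_half_pred_L P
    by_cases h : ν = μ <;> simp [h] <;> omega

/-- … (backward step): if `y₁ + e_μ` is the centre of `y` then `y₁ ∈ B(y)`. [cite: Balaban1987RG1, (0.3) p.252] -/
theorem blockOf_eq_of_shift_eq_emb {j : ℕ} (hj : j + 1 ≤ P.m + P.K) {y : Site P (j + 1)} {y₁ : Site P j} {μ : Fin P.d} (h : y₁.shift μ = emb y) :
    blockOf y₁ = y := by
  have hy₁ : y₁ = (emb y).unshift μ := by rw [← h, B10StarCount.unshift_shift]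
  refine T4Continuum.blockOf_eq_of_near_emb hj y _ (fun ν => if ν = μ then -1 else 0) (fun ν => ?_) (fun ν => ?_)
  · rw [hy₁, Site.unshift_apply]
    by_cases h : ν = μ
    · subst h; simp [sub_eq_add_neg]
    · simp [h]
  · have := one_le_half_pred_L P
    by_cases h : ν = μ <;> simp [h] <;> omega

/-- **THE DEPTH PROFILE (2.4), lower half**: if the `j₀`-block of `x` lies in `Λ_{j₀}` then `x ∈ Ω_i` for every `i ≤ j₀`. [cite: Balaban1984PropagatorsII, (2.1)-(2.4) p.224] -/
theorem inOm_of_le_depth (D : Domains P) {x : Site P 0} {j₀ : ℕ} (hj₀ : D.LamSite j₀ (iterBlockOf j₀ x)) {i : ℕ} (hi : i ≤ j₀) : D.InOm i x :=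
  D.inOm_of_le hi hj₀.1

/-- **THE DEPTH PROFILE (2.4), upper half**: … and `x ∉ Ω_i` for every `i > j₀`. [cite: Balaban1984PropagatorsII, (2.1)-(2.4) p.224] -/
theorem not_inOm_of_depth_lt (D : Domains P) {x : Site P 0} {j₀ : ℕ} (hj₀ : D.LamSite j₀ (iterBlockOf j₀ x)) {i : ℕ} (hi : j₀ < i) : ¬ D.InOm i x :=
  D.not_inOm_of_not_deep hi hj₀.2

/-- A `j`-site outside `Ω_j^{(j)}` is not deep (nesting). [cite: Balaban1984PropagatorsII, (2.1) p.224] -/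
theorem not_deep_of_not_mem (D : Domains P) {j : ℕ} {y : Site P j} (hy : y ∉ D.Om j) : ¬ D.Deep j y := fun h => hy (D.nested y h)

/-! ## §1  Comb families: uniqueness, and the one-step recursion on a block where `Q_iZ` vanishes -/

section Comb

variable (Λ : (i : ℕ) → (PBond P 0 → Matrix (Fin N) (Fin N) ℂ) → Site P i → Matrix (Fin N) (Fin N) ℂ)
  (hΛ0 : ∀ Y y, Λ 0 Y y = 0)
  (hΛs : ∀ (i : ℕ) (Y : PBond P 0 → Matrix (Fin N) (Fin N) ℂ) (y : Site P (i + 1)),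
    Λ (i + 1) Y y = (P.L ^ i : ℕ) • combMean (bondAvgIter i Y) y + Λ i Y (emb y))

include hΛ0 hΛs in
/-- The recursion `Λ₀ = 0`, `Λ_{i+1}(Y) = Lⁱ·λ̄(Q_iY) + Λ_i(Y)∘emb` DETERMINES the hierarchical comb functional. [cite: Balaban1985Averaging, (62) p.28] -/
theorem combFamily_unique (Λ' : (i : ℕ) → (PBond P 0 → Matrix (Fin N) (Fin N) ℂ) → Site P i → Matrix (Fin N) (Fin N) ℂ)
    (hΛ'0 : ∀ Y y, Λ' 0 Y y = 0)
    (hΛ's : ∀ (i : ℕ) (Y : PBond P 0 → Matrix (Fin N) (Fin N) ℂ) (y : Site P (i + 1)),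
      Λ' (i + 1) Y y = (P.L ^ i : ℕ) • combMean (bondAvgIter i Y) y + Λ' i Y (emb y)) :
    ∀ (i : ℕ) (Y : PBond P 0 → Matrix (Fin N) (Fin N) ℂ) (y : Site P i), Λ' i Y y = Λ i Y y
  | 0, Y, y => by rw [hΛ0, hΛ'0]
  | i + 1, Y, y => by rw [hΛs, hΛ's, combFamily_unique Λ' hΛ'0 hΛ's i Y (emb y)]

include hΛs in
/-- ★ **ONE STEP OF THE RECURSION ON A BLOCK WHERE `Q_iZ` VANISHES**: if `(Q_iZ)(c) = 0` for every `i`-bond `c` with both end-points in `B(y)`, then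
`Λ_{i+1}Z(y) = Λ_iZ(emb y)` — the comb mean `λ̄(Q_iZ)(y)` reads `Q_iZ` only on the staircases of (0.3) inside `B(y)`.
[cite: Balaban1985Averaging, (62) p.28; Balaban1987RG1, (0.3) p.252] -/
theorem comb_succ_eq_of_block {i : ℕ} (hi : i + 1 ≤ P.m + P.K) (Z : PBond P 0 → Matrix (Fin N) (Fin N) ℂ) (y : Site P (i + 1))
    (hZ : ∀ c : PBond P i, blockOf c.src = y → blockOf c.tgt = y → bondAvgIter i Z c = 0) : Λ (i + 1) Z y = Λ i Z (emb y) := by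
  have hcomb : combMean (bondAvgIter i Z) y = 0 := by
    rw [← combMean_zero (P := P) (n := Fin N) (j := i) y]
    refine combMean_congr_stairs y fun σ r s hs => ?_
    have hb := T4Continuum.blockOf_ends_of_mem_stairWalk hi y r σ s hs
    exact hZ s.bond hb.1 hb.2
  rw [hΛs, hcomb, smul_zero, zero_add]

include hΛ0 hΛs in
/-- **SUP LETTER OF THE HIERARCHICAL COMB FUNCTIONAL**: `‖Z_b‖ ≤ s` for all `b` ⇒ `‖Λ_jZ(y)‖ ≤ (d+2)·L·s·(L^j − 1)∕(L − 1)` (each comb mean of the convex combination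
`Q_iZ` is `≤ (d+2)L·s`, UST `Prop7LinAvgOnto.norm_combMean_le`; geometric sum of the weights `Lⁱ`). [cite: Balaban1985Averaging, (62) p.28; Balaban1984PropagatorsI, (1.18) p.20] -/
theorem norm_combFamily_le {Z : PBond P 0 → Matrix (Fin N) (Fin N) ℂ} {s : ℝ} (hs : 0 ≤ s) (hZ : ∀ b, ‖Z b‖ ≤ s) :
    ∀ (j : ℕ) (y : Site P j), ‖Λ j Z y‖ ≤ ((P.d + 2) * P.L : ℕ) * s * (((P.L : ℝ) ^ j - 1) / ((P.L : ℝ) - 1))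
  | 0, y => by rw [hΛ0, norm_zero, pow_zero, sub_self, zero_div, mul_zero]
  | j + 1, y => by
    have hL1 : (1 : ℝ) < P.L := by exact_mod_cast P.hL.2
    have hLm1 : (0 : ℝ) < (P.L : ℝ) - 1 := sub_pos.mpr hL1
    have hQ : ∀ c, ‖bondAvgIter j Z c‖ ≤ s := fun c =>
      Literature.MathematicalPhysics.QuantumFieldTheory.BalabanImbrieJaffe1984to88.BIJ85GaugeFnBound513.norm_bondAvgIter_le j Z hZ c
    have h1 : ‖(P.L ^ j : ℕ) • combMean (bondAvgIter j Z) y‖ ≤ (P.L : ℝ) ^ j * (((P.d + 2) * P.L : ℕ) * s) := by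
      rw [← Nat.cast_smul_eq_nsmul ℝ, norm_smul, Real.norm_natCast, Nat.cast_pow]
      exact mul_le_mul_of_nonneg_left (Prop7LinAvgOnto.norm_combMean_le _ hs hQ y) (by positivity)
    have h2 := norm_combFamily_le hs hZ j (emb y)
    rw [hΛs]
    refine (norm_add_le _ _).trans ((add_le_add h1 h2).trans (le_of_eq ?_))
    rw [pow_succ]
    field_simp
    ring

include hΛ0 hΛs in
/-- … in the rounder form `‖Λ_jZ(y)‖ ≤ (d+2)·L^{j+1}·s` (`(L^j − 1)∕(L − 1) ≤ L^j` for `L ≥ 2`). [cite: Balaban1985Averaging, (62) p.28] -/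
theorem norm_combFamily_le' {Z : PBond P 0 → Matrix (Fin N) (Fin N) ℂ} {s : ℝ} (hs : 0 ≤ s) (hZ : ∀ b, ‖Z b‖ ≤ s) (j : ℕ) (y : Site P j) :
    ‖Λ j Z y‖ ≤ ((P.d + 2 : ℕ) : ℝ) * (P.L : ℝ) ^ (j + 1) * s := by
  have hL1 : (1 : ℝ) < P.L := by exact_mod_cast P.hL.2
  have hLm1 : (0 : ℝ) < (P.L : ℝ) - 1 := sub_pos.mpr hL1
  have hL2 : (2 : ℝ) ≤ P.L := by exact_mod_cast P.hL.2
  have hgeom : ((P.L : ℝ) ^ j - 1) / ((P.L : ℝ) - 1) ≤ (P.L : ℝ) ^ j := by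
    rw [div_le_iff₀ hLm1]
    have hpow : (0 : ℝ) ≤ (P.L : ℝ) ^ j := by positivity
    nlinarith [mul_nonneg hpow (show (0 : ℝ) ≤ (P.L : ℝ) - 2 by linarith)]
  refine (norm_combFamily_le Λ hΛ0 hΛs hs hZ j y).trans ?_
  have h0 : (0 : ℝ) ≤ ((P.d + 2) * P.L : ℕ) * s := by positivity
  calc (((P.d + 2) * P.L : ℕ) : ℝ) * s * (((P.L : ℝ) ^ j - 1) / ((P.L : ℝ) - 1))
      ≤ (((P.d + 2) * P.L : ℕ) : ℝ) * s * (P.L : ℝ) ^ j := mul_le_mul_of_nonneg_left hgeom h0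
    _ = ((P.d + 2 : ℕ) : ℝ) * (P.L : ℝ) ^ (j + 1) * s := by push_cast; ring

end Comb

/-! ## §2  Touched sites of an index reading, their depth, and the collision lemma -/

section Touched

variable (D : Domains P)
  (hcollar : ∀ (i : ℕ) (e : PBond P (i + 1)), D.LamBond (i + 1) e → ∀ z : Site P i, (blockOf z = e.src ∨ blockOf z = e.tgt) → z ∈ D.Om i)
  {I : (j : ℕ) → PBond P j → Prop}
  (hI₁ : ∀ (j : ℕ) (b : PBond P j), I j b → D.LamSite j b.src ∨ D.LamSite j b.tgt)
  (hI₂ : ∀ (j : ℕ) (c : PBond P j), D.LamSite j c.src → D.LamSite j c.tgt → I j c)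

include hI₁ in
/-- An end-point `y` of an index bond `b` is EITHER a `Λ_j`-site OR the other end-point `y₁` is, and then `b = [y, y₁]` or `b = [y₁, y]`.
[cite: Balaban1984PropagatorsII, (2.3) p.224; Balaban1988Convergent, (2.10) p.256] -/
theorem touched_normal_form {j : ℕ} {b : PBond P j} (hb : I j b) {y : Site P j} (hyb : y = b.src ∨ y = b.tgt) :
    D.LamSite j y ∨ ∃ y₁ : Site P j, D.LamSite j y₁ ∧ ((b.src = y ∧ b.tgt = y₁) ∨ (b.src = y₁ ∧ b.tgt = y)) := by
  rcases hI₁ j b hb with h | h <;> rcases hyb with rfl | rfl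
  · exact Or.inl h
  · exact Or.inr ⟨b.src, h, Or.inr ⟨rfl, rfl⟩⟩
  · exact Or.inr ⟨b.tgt, h, Or.inl ⟨rfl, rfl⟩⟩
  · exact Or.inl h

include hI₁ in
/-- An index bond with an end-point OUTSIDE `Ω_j^{(j)}` is a `Λ_j`-bond of [B6] (2.3) (its other end-point is the `Λ_j`-site; no end-point is deep).
[cite: Balaban1984PropagatorsII, (2.3) p.224] -/
theorem lamBond_of_touched_not_mem {j : ℕ} {b : PBond P j} (hb : I j b) {y : Site P j} (hyb : y = b.src ∨ y = b.tgt) (hy : y ∉ D.Om j) :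
    D.LamBond j b := by
  have hnd : ¬ D.Deep j y := not_deep_of_not_mem D hy
  rcases touched_normal_form D hI₁ hb hyb with h | ⟨y₁, hy₁, h⟩
  · exact absurd h.1 hy
  · rcases h with ⟨h1, h2⟩ | ⟨h1, h2⟩
    · exact ⟨Or.inr (h2 ▸ hy₁.1), h1 ▸ hnd, h2 ▸ hy₁.2⟩
    · exact ⟨Or.inl (h1 ▸ hy₁.1), h1 ▸ hy₁.2, h2 ▸ hnd⟩

include hcollar hI₁ in
/-- ★ **THE DEPTH TRICHOTOMY OF A TOUCHED SITE** (collar property): let `y = Bʲ(x)` be an end-point of an index bond of level `j` and `j₀` the territory of `x`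
(`B^{j₀}(x) ∈ Λ_{j₀}`).  Then EITHER `j₀ = j` (`y` is the `Λ_j`-site of `x`), OR `j = j₀ + 1`, `y ∉ Ω_j^{(j)}` and the bond is a (2.3)-bond (OUTER boundary of `Ω_j`:
by the collar all sub-blocks of `y` lie in `Λ_{j₀}`), OR `j + 1 ≤ j₀` and `y` has a NON-deep lattice neighbour (INNER crossing into `Ω_{j+1}`).
[cite: Balaban1984PropagatorsII, (2.1)-(2.4) p.224] -/
theorem depth_cases_of_touched {j : ℕ} {b : PBond P j} (hb : I j b) {x : Site P 0} (hx : iterBlockOf j x = b.src ∨ iterBlockOf j x = b.tgt)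
    {j₀ : ℕ} (hj₀ : D.LamSite j₀ (iterBlockOf j₀ x)) :
    j₀ = j ∨ (j₀ + 1 = j ∧ iterBlockOf j x ∉ D.Om j ∧ D.LamBond j b) ∨
      (j + 1 ≤ j₀ ∧ ∃ (y₁ : Site P j) (μ : Fin P.d), ¬ D.Deep j y₁ ∧ (y₁ = (iterBlockOf j x).shift μ ∨ y₁.shift μ = iterBlockOf j x)) := by
  rcases touched_normal_form D hI₁ hb hx with hL | ⟨y₁, hy₁, hends⟩
  · exact Or.inl (D.lamSite_iterBlockOf_unique hj₀ hL)
  -- the geometric relation between `y = Bʲ(x)` and `y₁`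
  have hadj : ∃ μ : Fin P.d, y₁ = (iterBlockOf j x).shift μ ∨ y₁.shift μ = iterBlockOf j x := by
    rcases hends with ⟨h1, h2⟩ | ⟨h1, h2⟩
    · exact ⟨b.dir, Or.inl (by rw [← h1, ← h2]; rfl)⟩
    · exact ⟨b.dir, Or.inr (by rw [← h1, ← h2]; rfl)⟩
  obtain ⟨μ, hμ⟩ := hadj
  by_cases hmem : iterBlockOf j x ∈ D.Om j
  · by_cases hdeep : D.Deep j (iterBlockOf j x)
    · -- INNER CROSSING: `y` deep, `y₁` not
      refine Or.inr (Or.inr ⟨?_, y₁, μ, hy₁.2, hμ⟩)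
      by_contra hlt
      exact not_inOm_of_depth_lt D hj₀ (i := j + 1) (by omega) ((D.deep_iterBlockOf_iff j x).1 hdeep)
    · exact Or.inl (D.lamSite_iterBlockOf_unique hj₀ ⟨hmem, hdeep⟩)
  · -- OUTER BOUNDARY: the bond is a (2.3)-bond and the collar puts the sub-blocks of `y` into `Ω_{j-1}`
    have hLB : D.LamBond j b := lamBond_of_touched_not_mem D hI₁ hb hx hmem
    refine Or.inr (Or.inl ⟨?_, hmem, hLB⟩)
    -- `j ≥ 1` since `Ω₀ = T`
    obtain ⟨i, rfl⟩ : ∃ i, j = i + 1 := by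
      rcases Nat.eq_zero_or_eq_succ_pred j with h | h
      · exfalso; subst h; rw [D.Om_zero] at hmem; exact hmem (Finset.mem_univ _)
      · exact ⟨j - 1, h⟩
    -- the `i`-block of `x` lies in `Ω_i` by the collar, and `x ∉ Ω_{i+1}`
    have hin : D.InOm i x := hcollar i b hLB (iterBlockOf i x) (by rw [← iterBlockOf_succ]; exact hx)
    have hout : ¬ D.InOm (i + 1) x := hmem
    have h1 : ¬ j₀ < i := fun h => not_inOm_of_depth_lt D hj₀ h hin
    have h2 : ¬ i + 1 ≤ j₀ := fun h => hout (inOm_of_le_depth D hj₀ h)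
    omega

variable (Λ : (i : ℕ) → (PBond P 0 → Matrix (Fin N) (Fin N) ℂ) → Site P i → Matrix (Fin N) (Fin N) ℂ)
  (hΛ0 : ∀ Y y, Λ 0 Y y = 0)
  (hΛs : ∀ (i : ℕ) (Y : PBond P 0 → Matrix (Fin N) (Fin N) ℂ) (y : Site P (i + 1)),
    Λ (i + 1) Y y = (P.L ^ i : ℕ) • combMean (bondAvgIter i Y) y + Λ i Y (emb y))

include hcollar hI₁ hI₂ hΛs in
/-- ★★ **THE COLLISION LEMMA**: if two touched sites `y` (level `j`) and `y′` (level `j′ > j`) — end-points of index bonds — have the SAME centre, then `j′ = j + 1`,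
`y = emb y′`, `y′` is an outer-boundary site all of whose sub-blocks are `Λ_j`-sites, and for every `Z` in print's kernel `Λ_jZ(y) = Λ_{j′}Z(y′)` (the comb mean
of `Q_jZ ≡ 0` inside `B(y′)` vanishes).  [Depth trichotomy at both levels: an inner-crossing `y` central in its `(j+1)`-block would have only deep neighbours; an outer
`y` has depth `j − 1 < j′ − 1`.] [cite: Balaban1984PropagatorsII, (2.1)-(2.4) p.224; Balaban1985Averaging, (62) p.28] -/
theorem comb_eq_of_collision {Z : PBond P 0 → Matrix (Fin N) (Fin N) ℂ} (h0 : ∀ (j : ℕ) (c : PBond P j), I j c → bondAvgIter j Z c = 0)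
    {j j' : ℕ} {b : PBond P j} {b' : PBond P j'} (hb : I j b) (hb' : I j' b') {y : Site P j} {y' : Site P j'}
    (hyb : y = b.src ∨ y = b.tgt) (hyb' : y' = b'.src ∨ y' = b'.tgt) (hlt : j < j') (heq : embIter j y = embIter j' y') :
    Λ j Z y = Λ j' Z y' := by
  have hjk' : j' ≤ D.k := by rcases hI₁ j' b' hb' with h | h <;> exact D.le_of_lamSite h
  have hj'P : j' ≤ P.m + P.K := hjk'.trans D.hk
  have hjP : j ≤ P.m + P.K := by omega
  obtain ⟨x, hx⟩ : ∃ x : Site P 0, embIter j' y' = x := ⟨_, rfl⟩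
  have hyx : iterBlockOf j x = y := by rw [← hx, ← heq, Node00.iterBlockOf_embIter j hjP]
  have hy'x : iterBlockOf j' x = y' := by rw [← hx, Node00.iterBlockOf_embIter j' hj'P]
  obtain ⟨j₀, -, hj₀⟩ := D.exists_lamSite_iterBlockOf x
  have hc := depth_cases_of_touched D hcollar hI₁ hb (x := x) (by rw [hyx]; exact hyb) hj₀
  have hc' := depth_cases_of_touched D hcollar hI₁ hb' (x := x) (by rw [hy'x]; exact hyb') hj₀
  rcases hc with h₀ | ⟨h₀, -, -⟩ | ⟨h₀, y₁, μ, hy₁, hadj⟩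
  · -- `y` is the Λ_j-site of `x`: then `y′` must be the outer-boundary case at level `j + 1`
    rcases hc' with h₀' | ⟨h₀', hout', hLB'⟩ | ⟨h₀', -⟩
    · omega
    · have hj1 : j' = j + 1 := by omega
      subst hj1
      -- `y = emb y′`
      have hyy' : y = emb y' := by rw [← hyx, ← hx]; exact Node00.iterBlockOf_embIter j hjP (emb y')
      -- all sub-blocks of `y′` are Λ_j-sites
      have hblk : ∀ w : Site P j, blockOf w = y' → D.LamSite j w := fun w hw =>
        ⟨hcollar j b' hLB' w (by rw [hw]; exact hyb'), fun hd => hout' (by rw [hy'x] at *; exact hw ▸ hd)⟩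
      rw [hyy', comb_succ_eq_of_block Λ hΛs hj'P Z y' fun c h1 h2 => h0 j c (hI₂ j c (hblk _ h1) (hblk _ h2))]
    · omega
  · -- `y` outer at level `j = j₀ + 1`: no touched site strictly above
    rcases hc' with h₀' | ⟨h₀', -⟩ | ⟨h₀', -⟩ <;> omega
  · -- `y` inner-crossing (deep) with a non-deep neighbour `y₁`, yet central in its `(j+1)`-block: contradiction
    exfalso
    have hyemb : y = emb (iterBlockOf (j + 1) x) := by rw [← hyx, ← hx]; exact iterBlockOf_embIter_eq_emb hlt hj'P y'
    have hj1P : j + 1 ≤ P.m + P.K := by omega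
    have hblk₁ : blockOf y₁ = iterBlockOf (j + 1) x := by
      rcases hadj with h | h
      · rw [h, hyx, hyemb]; exact blockOf_emb_shift hj1P _ μ
      · exact blockOf_eq_of_shift_eq_emb hj1P (by rw [h, hyx, hyemb])
    -- `y` is deep: `x ∈ Ω_{j+1}`
    have hdeep : D.InOm (j + 1) x := inOm_of_le_depth D hj₀ h₀
    exact hy₁ (by unfold Domains.Deep; rw [hblk₁]; exact hdeep)

end Touched

end Summit.QuantumFields.YangMills.Theorems.K0Stub1TouchedCentresOfDomains

end
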